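import Summits.CriticalPhenomena.PercolationContinuityZ3.Theorems.PercNearOneGluingNoHeavyLowerTailSahiTwoChainWRInduction
import HarnessLib

/-!
# Two-chain coefficient positivity (TCP): Sahi's `E_n` under a product weight on the product of two finite chains is a
# polynomial with nonnegative coefficients in the point masses

Support file of the one-cut programme (crux `NoHeavyLowerTail`, stmt-CriticalPhenomena-4575; cell `prim-masterthm`, seat P3, gen 16;
`run/shared/lean/prim/prim-masterthm/prim-masterthm-p3/HIERARCHY.md` §24; memo
`run/shared/lean/prim/prim-masterthm/FROM-prim-masterthm-p3-g16-TWO-CHAIN-COEFFICIENTS.md`).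

* **`sahiE_prodWeight_eq_sum_et`** (THE BRIDGE, any functions, any finite types): for probability vectors `ν` on `α`, `ν'` on `β`,
  `E_n^{ν⊗ν'}(f) = Σ_{r : Fin n → α} Σ_{c : Fin n → β} (Π_a ν(r a)) (Π_b ν'(c b)) · Ẽ_n^{Fin n × Fin n}((a,b) ↦ f_i(r a, c b))` —
  both sides satisfy the Lieb–Sahi recursion [LiebSahi2021, Prop. 3.3] (deletion averaging + transport + marginalisation of the
  deleted slots).
* **`et_coef_nonneg`** (TCP): on finite chains `α, β` every coefficient is `≥ 0` for nonnegative monotone `f` (`et_nonneg_of_monotone`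
  after sorting the two tuples).
* `sahiE_prodWeight_nonneg_coefficientwise` — hence `E_n^{ν⊗ν'}(f) ≥ 0`: Lieb–Sahi's two-dimensional theorem [LiebSahi2021, Thm. 3.7]
  for every product weight (tree: `Sahi2008.sahiPositive_prodWeight`), re-proved with a COEFFICIENTWISE certificate — the conjecture
  TCP of the gen-15 memo §8; consequences for the mixture ladder (Bernstein positivity of every cell of a monotone mixture of product
  measures, at every order) are drawn in the sequel.
Everything PROVED, standard axioms; no new definitions. [this work]
-/

noncomputable section

open scoped Classical

namespace Summit.CriticalPhenomena.PercolationContinuityZ3.Theorems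

open Finset Function
open Literature.Combinatorics.Sahi2008

namespace SahiTwoChain

/-! ## The bridge: Sahi's `E_n` under a product weight is a nonnegative combination of values of `Ẽ_n` -/

section Bridge

variable {γ : Type*} [Fintype γ]

/-- Splitting a weighted sum over `(n+1)`-tuples at the coordinate `p`: `r ↦ (r p, r ∘ p.succAbove)`. [this work] -/
theorem sum_pi_weight_split {n : ℕ} (ν : γ → ℝ) (p : Fin (n + 1)) (G : γ → (Fin n → γ) → ℝ) :
    ∑ r : Fin (n + 1) → γ, (∏ j, ν (r j)) * G (r p) (fun j => r (p.succAbove j)) =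
      ∑ x : γ, ∑ r' : Fin n → γ, (ν x * ∏ j, ν (r' j)) * G x r' := by
  rw [← (Fin.insertNthEquiv (fun _ => γ) p).sum_comp, Fintype.sum_prod_type]
  refine Fintype.sum_congr _ _ fun x => Fintype.sum_congr _ _ fun r' => ?_
  simp only [Fin.insertNthEquiv_apply, Fin.insertNth_apply_same, Fin.insertNth_apply_succAbove,
    Fin.prod_univ_succAbove _ p]

/-- Sums over `1`-tuples (plumbing). [this work] -/
theorem sum_pi_one (G : (Fin 1 → γ) → ℝ) : ∑ r : Fin 1 → γ, G r = ∑ x : γ, G (fun _ => x) := by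
  rw [← (Equiv.funUnique (Fin 1) γ).symm.sum_comp]
  refine Fintype.sum_congr _ _ fun x => ?_
  congr 1

variable {α β : Type*} [Fintype α] [Fintype β]

/-- Two-coordinate marginalisation of the product weights at the slots `a` (rows) and `b` (columns). [this work] -/
theorem sum_weights_split {n : ℕ} (ν : α → ℝ) (ν' : β → ℝ) (a b : Fin (n + 1)) (h : α → β → ℝ)
    (H : (Fin n → α) → (Fin n → β) → ℝ) :
    ∑ r : Fin (n + 1) → α, ∑ c : Fin (n + 1) → β, ((∏ j, ν (r j)) * ∏ j, ν' (c j)) *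
        (h (r a) (c b) * H (fun j => r (a.succAbove j)) (fun j => c (b.succAbove j))) =
      (∑ x, ∑ y, ν x * ν' y * h x y) *
        ∑ r' : Fin n → α, ∑ c' : Fin n → β, ((∏ j, ν (r' j)) * ∏ j, ν' (c' j)) * H r' c' := by
  -- split the rows at `a`
  have step1 : ∀ r : Fin (n + 1) → α,
      ∑ c : Fin (n + 1) → β, ((∏ j, ν (r j)) * ∏ j, ν' (c j)) *
        (h (r a) (c b) * H (fun j => r (a.succAbove j)) (fun j => c (b.succAbove j))) =
      (∏ j, ν (r j)) * ∑ c : Fin (n + 1) → β, (∏ j, ν' (c j)) *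
        (h (r a) (c b) * H (fun j => r (a.succAbove j)) (fun j => c (b.succAbove j))) := by
    intro r
    rw [mul_sum]
    exact Fintype.sum_congr _ _ fun c => by ring
  simp_rw [step1]
  rw [sum_pi_weight_split ν a (fun x r' => ∑ c : Fin (n + 1) → β, (∏ j, ν' (c j)) *
    (h x (c b) * H r' (fun j => c (b.succAbove j))))]
  -- split the columns at `b`
  have step2 : ∀ (x : α) (r' : Fin n → α),
      ∑ c : Fin (n + 1) → β, (∏ j, ν' (c j)) * (h x (c b) * H r' (fun j => c (b.succAbove j))) =
        ∑ y : β, ∑ c' : Fin n → β, (ν' y * ∏ j, ν' (c' j)) * (h x y * H r' c') :=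
    fun x r' => sum_pi_weight_split ν' b (fun y c' => h x y * H r' c')
  simp_rw [step2]
  -- rearrange both sides into the same quadruple sum
  rw [Finset.sum_mul_sum]
  refine Fintype.sum_congr _ _ fun x => Fintype.sum_congr _ _ fun r' => ?_
  rw [Finset.mul_sum, Finset.sum_mul_sum]
  refine Fintype.sum_congr _ _ fun y => ?_
  rw [Finset.mul_sum]
  exact Fintype.sum_congr _ _ fun c' => by ring

/-- **THE BRIDGE.**  For probability vectors `ν` on `α` and `ν'` on `β` and ANY functions `f_0,…,f_{n−1}` on `α × β`, Sahi's
functional under the product weight is the combination of the values of `Ẽ_n` on the `n × n` slot grid, pulled back along all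
pairs of `n`-tuples of points, with the monomial weights `Π_a ν(r_a) · Π_b ν'(c_b)`:
`E_n^{ν⊗ν'}(f) = Σ_{r : [n]→α} Σ_{c : [n]→β} ν^r ν'^c · Ẽ_n^{[n]×[n]}((a,b) ↦ f_i(r_a, c_b))`.  Proof: both sides satisfy the
Lieb–Sahi recursion (`et_succ_succ` + deletion averaging `et_sum_erase` + transport `et_erase_univ_eq` + marginalisation). [this work] -/
theorem sahiE_prodWeight_eq_sum_et (ν : α → ℝ) (ν' : β → ℝ) (hν : ∑ x, ν x = 1) (hν' : ∑ y, ν' y = 1) :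
    ∀ (n : ℕ) (f : Fin n → α × β → ℝ),
      sahiE (fun p : α × β => ν p.1 * ν' p.2) n f =
        ∑ r : Fin n → α, ∑ c : Fin n → β, ((∏ j, ν (r j)) * ∏ j, ν' (c j)) *
          et (univ : Finset (Fin n)) (univ : Finset (Fin n)) n (fun i (p : Fin n × Fin n) => f i (r p.1, c p.2))
  | 0, f => by simp [sahiE_zero, et_zero]
  | 1, f => by
    rw [sahiE_one_apply, ex_def, Fintype.sum_prod_type]
    have h1 : ∀ (r : Fin 1 → α) (c : Fin 1 → β),
        et (univ : Finset (Fin 1)) (univ : Finset (Fin 1)) 1 (fun i (p : Fin 1 × Fin 1) => f i (r p.1, c p.2)) =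
          f 0 (r 0, c 0) := by
      intro r c
      rw [et_one, Finset.univ_product_univ, Fintype.sum_prod_type]
      simp
    simp_rw [h1, Fin.prod_univ_one]
    rw [sum_pi_one]
    refine Fintype.sum_congr _ _ fun x => ?_
    rw [sum_pi_one]
  | n + 2, f => by
    -- abbreviations
    have hN : ((univ : Finset (Fin (n + 2))).card : ℝ) = (n : ℝ) + 2 := by simp
    have hN0 : ((n : ℝ) + 2) * ((n : ℝ) + 2) ≠ 0 := by positivity
    have h11 : ∑ x, ∑ y, ν x * ν' y * (1 : ℝ) = 1 := by
      simp only [mul_one]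
      rw [← Finset.sum_mul_sum, hν, hν', one_mul]
    -- the left-hand side by the Lieb–Sahi recursion and the induction hypothesis
    rw [sahiE_succ_succ]
    have IH1 := fun i : Fin (n + 1) =>
      sahiE_prodWeight_eq_sum_et ν ν' hν hν' (n + 1) (update (Fin.tail f) i (Fin.tail f i * f 0))
    have IH2 := sahiE_prodWeight_eq_sum_et ν ν' hν hν' (n + 1) (Fin.tail f)
    simp only [IH1, IH2]
    -- the right-hand side by the recursion of `Ẽ`, with the product term transported to the smaller slot grid
    have hrec : ∀ (r : Fin (n + 2) → α) (c : Fin (n + 2) → β),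
        et (univ : Finset (Fin (n + 2))) univ (n + 2) (fun i (p : Fin (n + 2) × Fin (n + 2)) => f i (r p.1, c p.2)) =
          (∑ i : Fin (n + 1), et (univ : Finset (Fin (n + 2))) univ (n + 1)
              (fun j (p : Fin (n + 2) × Fin (n + 2)) => update (Fin.tail f) i (Fin.tail f i * f 0) j (r p.1, c p.2))) -
          (∑ z : Fin (n + 2) × Fin (n + 2), f 0 (r z.1, c z.2) *
              et (univ : Finset (Fin (n + 1))) univ (n + 1)
                (fun j (p : Fin (n + 1) × Fin (n + 1)) => Fin.tail f j (r (z.1.succAbove p.1), c (z.2.succAbove p.2)))) /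
            (((n : ℝ) + 2) * ((n : ℝ) + 2)) := by
      intro r c
      rw [et_succ_succ, hN, Finset.univ_product_univ]
      have hupd : ∀ i : Fin (n + 1), update (Fin.tail fun i (p : Fin (n + 2) × Fin (n + 2)) => f i (r p.1, c p.2)) i
          (Fin.tail (fun i (p : Fin (n + 2) × Fin (n + 2)) => f i (r p.1, c p.2)) i *
            fun (p : Fin (n + 2) × Fin (n + 2)) => f 0 (r p.1, c p.2)) =
          fun j (p : Fin (n + 2) × Fin (n + 2)) => update (Fin.tail f) i (Fin.tail f i * f 0) j (r p.1, c p.2) := by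
        intro i
        funext j p
        by_cases hj : j = i
        · subst hj
          simp only [update_self, Pi.mul_apply, Fin.tail]
        · simp only [update_of_ne hj, Fin.tail]
      simp only [hupd]
      congr 1
      congr 1
      refine Fintype.sum_congr _ _ fun z => ?_
      rw [et_erase_univ_eq]
      rfl
    simp only [hrec]
    -- first group: deletion averaging on the `(n+2)`-slot grid, then marginalise the deleted slots
    have hA : ∀ i : Fin (n + 1),
        ∑ r : Fin (n + 2) → α, ∑ c : Fin (n + 2) → β, ((∏ j, ν (r j)) * ∏ j, ν' (c j)) *
          et (univ : Finset (Fin (n + 2))) univ (n + 1)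
            (fun j (p : Fin (n + 2) × Fin (n + 2)) => update (Fin.tail f) i (Fin.tail f i * f 0) j (r p.1, c p.2)) =
        ∑ r' : Fin (n + 1) → α, ∑ c' : Fin (n + 1) → β, ((∏ j, ν (r' j)) * ∏ j, ν' (c' j)) *
          et (univ : Finset (Fin (n + 1))) univ (n + 1)
            (fun j (p : Fin (n + 1) × Fin (n + 1)) => update (Fin.tail f) i (Fin.tail f i * f 0) j (r' p.1, c' p.2)) := by
      intro i
      set g := update (Fin.tail f) i (Fin.tail f i * f 0) with hg
      -- deletion averaging: `Ẽ` on the big slot grid is the average over the deleted slot pairs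
      have havg : ∀ (r : Fin (n + 2) → α) (c : Fin (n + 2) → β),
          et (univ : Finset (Fin (n + 2))) univ (n + 1) (fun j (p : Fin (n + 2) × Fin (n + 2)) => g j (r p.1, c p.2)) =
            (∑ z : Fin (n + 2) × Fin (n + 2), et (univ : Finset (Fin (n + 1))) univ (n + 1)
              (fun j (p : Fin (n + 1) × Fin (n + 1)) => g j (r (z.1.succAbove p.1), c (z.2.succAbove p.2)))) /
              (((n : ℝ) + 2) * ((n : ℝ) + 2)) := by
        intro r c
        have h := et_sum_erase (n + 1) (univ : Finset (Fin (n + 2))) univ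
          (fun j (p : Fin (n + 2) × Fin (n + 2)) => g j (r p.1, c p.2)) (by simp) (by simp)
        rw [hN, Finset.univ_product_univ] at h
        rw [eq_div_iff hN0, mul_comm, ← h]
        refine Fintype.sum_congr _ _ fun z => ?_
        rw [et_erase_univ_eq]
        rfl
      simp_rw [havg, Finset.sum_div, Finset.mul_sum]
      simp_rw [Finset.sum_comm (s := (univ : Finset (Fin (n + 2) → β))) (t := (univ : Finset (Fin (n + 2) × Fin (n + 2))))]
      rw [Finset.sum_comm (s := (univ : Finset (Fin (n + 2) → α))) (t := (univ : Finset (Fin (n + 2) × Fin (n + 2))))]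
      have hz : ∀ z : Fin (n + 2) × Fin (n + 2),
          ∑ r : Fin (n + 2) → α, ∑ c : Fin (n + 2) → β, ((∏ j, ν (r j)) * ∏ j, ν' (c j)) *
            (et (univ : Finset (Fin (n + 1))) univ (n + 1)
              (fun j (p : Fin (n + 1) × Fin (n + 1)) => g j (r (z.1.succAbove p.1), c (z.2.succAbove p.2))) /
              (((n : ℝ) + 2) * ((n : ℝ) + 2))) =
          (∑ r' : Fin (n + 1) → α, ∑ c' : Fin (n + 1) → β, ((∏ j, ν (r' j)) * ∏ j, ν' (c' j)) *
            et (univ : Finset (Fin (n + 1))) univ (n + 1) (fun j (p : Fin (n + 1) × Fin (n + 1)) => g j (r' p.1, c' p.2))) /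
            (((n : ℝ) + 2) * ((n : ℝ) + 2)) := by
        intro z
        have h := sum_weights_split ν ν' z.1 z.2 (fun _ _ => (1 : ℝ))
          (fun r' c' => et (univ : Finset (Fin (n + 1))) univ (n + 1)
            (fun j (p : Fin (n + 1) × Fin (n + 1)) => g j (r' p.1, c' p.2)))
        rw [h11, one_mul] at h
        rw [← h, Finset.sum_div]
        refine Fintype.sum_congr _ _ fun r => ?_
        rw [Finset.sum_div]
        refine Fintype.sum_congr _ _ fun c => ?_
        ring
      simp_rw [hz]
      rw [Finset.sum_const, Finset.card_univ, Fintype.card_prod, Fintype.card_fin, nsmul_eq_mul]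
      push_cast
      field_simp
    -- second group: marginalise the slot pair read by the product term
    have hB : ∑ r : Fin (n + 2) → α, ∑ c : Fin (n + 2) → β, ((∏ j, ν (r j)) * ∏ j, ν' (c j)) *
        ((∑ z : Fin (n + 2) × Fin (n + 2), f 0 (r z.1, c z.2) *
          et (univ : Finset (Fin (n + 1))) univ (n + 1)
            (fun j (p : Fin (n + 1) × Fin (n + 1)) => Fin.tail f j (r (z.1.succAbove p.1), c (z.2.succAbove p.2)))) /
          (((n : ℝ) + 2) * ((n : ℝ) + 2))) =
        (∑ r' : Fin (n + 1) → α, ∑ c' : Fin (n + 1) → β, ((∏ j, ν (r' j)) * ∏ j, ν' (c' j)) *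
          et (univ : Finset (Fin (n + 1))) univ (n + 1) (fun j (p : Fin (n + 1) × Fin (n + 1)) => Fin.tail f j (r' p.1, c' p.2))) *
          ex (fun p : α × β => ν p.1 * ν' p.2) (f 0) := by
      simp only [Finset.sum_div, Finset.mul_sum]
      simp_rw [Finset.sum_comm (s := (univ : Finset (Fin (n + 2) → β))) (t := (univ : Finset (Fin (n + 2) × Fin (n + 2))))]
      rw [Finset.sum_comm (s := (univ : Finset (Fin (n + 2) → α))) (t := (univ : Finset (Fin (n + 2) × Fin (n + 2))))]
      have hz : ∀ z : Fin (n + 2) × Fin (n + 2),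
          ∑ r : Fin (n + 2) → α, ∑ c : Fin (n + 2) → β, ((∏ j, ν (r j)) * ∏ j, ν' (c j)) *
            (f 0 (r z.1, c z.2) * et (univ : Finset (Fin (n + 1))) univ (n + 1)
              (fun j (p : Fin (n + 1) × Fin (n + 1)) => Fin.tail f j (r (z.1.succAbove p.1), c (z.2.succAbove p.2))) /
              (((n : ℝ) + 2) * ((n : ℝ) + 2))) =
          ((∑ x, ∑ y, ν x * ν' y * f 0 (x, y)) *
            ∑ r' : Fin (n + 1) → α, ∑ c' : Fin (n + 1) → β, ((∏ j, ν (r' j)) * ∏ j, ν' (c' j)) *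
              et (univ : Finset (Fin (n + 1))) univ (n + 1)
                (fun j (p : Fin (n + 1) × Fin (n + 1)) => Fin.tail f j (r' p.1, c' p.2))) /
            (((n : ℝ) + 2) * ((n : ℝ) + 2)) := by
        intro z
        have h := sum_weights_split ν ν' z.1 z.2 (fun x y => f 0 (x, y))
          (fun r' c' => et (univ : Finset (Fin (n + 1))) univ (n + 1)
            (fun j (p : Fin (n + 1) × Fin (n + 1)) => Fin.tail f j (r' p.1, c' p.2)))
        rw [← h, Finset.sum_div]
        refine Fintype.sum_congr _ _ fun r => ?_
        rw [Finset.sum_div]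
        refine Fintype.sum_congr _ _ fun c => ?_
        ring
      simp_rw [hz]
      rw [Finset.sum_const, Finset.card_univ, Fintype.card_prod, Fintype.card_fin, nsmul_eq_mul, ex_def,
        Fintype.sum_prod_type]
      push_cast
      field_simp
    simp only [mul_sub, Finset.sum_sub_distrib]
    rw [hB]
    congr 1
    simp_rw [Finset.mul_sum]
    simp_rw [Finset.sum_comm (s := (univ : Finset (Fin (n + 2) → β))) (t := (univ : Finset (Fin (n + 1))))]
    rw [Finset.sum_comm (s := (univ : Finset (Fin (n + 2) → α))) (t := (univ : Finset (Fin (n + 1))))]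
    exact Fintype.sum_congr _ _ fun i => (hA i).symm

omit [Fintype α] [Fintype β] in
/-- **TCP — two-chain coefficient positivity.**  On the product of two finite chains, every coefficient `Ẽ_n` in the bridge
expansion of `E_n^{ν⊗ν'}(f)` is nonnegative for nonnegative monotone `f` (sort the two tuples of points, then
`et_nonneg_of_monotone`). [this work] -/
theorem et_coef_nonneg [LinearOrder α] [LinearOrder β] {n : ℕ} (f : Fin n → α × β → ℝ) (hf : ∀ i z, 0 ≤ f i z)
    (hmono : ∀ i, Monotone (f i)) (r : Fin n → α) (c : Fin n → β) :
    0 ≤ et (univ : Finset (Fin n)) (univ : Finset (Fin n)) n (fun i (p : Fin n × Fin n) => f i (r p.1, c p.2)) := by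
  let σ : Equiv.Perm (Fin n) := Tuple.sort r
  let τ : Equiv.Perm (Fin n) := Tuple.sort c
  have hr : Monotone (r ∘ σ) := Tuple.monotone_sort r
  have hc : Monotone (c ∘ τ) := Tuple.monotone_sort c
  rw [← et_comp_equiv σ τ n]
  refine et_nonneg_of_monotone le_rfl _ (fun i z => hf i _) fun i => ?_
  intro p q hpq
  exact hmono i ⟨hr hpq.1, hc hpq.2⟩

/-- **Coefficientwise Lieb–Sahi, packaged**: `E_n^{ν⊗ν'}(f) = Σ_{r,c} (Π ν(r_a))(Π ν'(c_b)) · κ(r,c)` with every `κ(r,c) ≥ 0`, for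
nonnegative monotone `f` on the product of two finite chains and probability vectors `ν, ν'`.  In particular (summing)
Lieb–Sahi's Theorem 3.7 for every product weight, now with a certificate that is a polynomial identity with nonnegative
coefficients in the point masses. [this work] -/
theorem sahiE_prodWeight_nonneg_coefficientwise [LinearOrder α] [LinearOrder β] (ν : α → ℝ) (ν' : β → ℝ)
    (hν0 : ∀ x, 0 ≤ ν x) (hν : ∑ x, ν x = 1) (hν'0 : ∀ y, 0 ≤ ν' y) (hν' : ∑ y, ν' y = 1) {n : ℕ}
    (f : Fin n → α × β → ℝ) (hf : ∀ i z, 0 ≤ f i z) (hmono : ∀ i, Monotone (f i)) :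
    0 ≤ sahiE (fun p : α × β => ν p.1 * ν' p.2) n f := by
  rw [sahiE_prodWeight_eq_sum_et ν ν' hν hν' n f]
  refine Finset.sum_nonneg fun r _ => Finset.sum_nonneg fun c _ => mul_nonneg (mul_nonneg ?_ ?_) ?_
  · exact Finset.prod_nonneg fun j _ => hν0 _
  · exact Finset.prod_nonneg fun j _ => hν'0 _
  · exact et_coef_nonneg f hf hmono r c

end Bridge

end SahiTwoChain

end Summit.CriticalPhenomena.PercolationContinuityZ3.Theorems
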